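import Literature.Barriers.PneNP.TSPExtensionComplexityRothvossAssembly
import Literature.Barriers.PneNP.TSPExtensionComplexityRothvossSampling
import HarnessLib

/-!
# Rothvoß's TSP bound from the sampler inequality (Lemma 7 in expectation form)

Support file for the fact `Literature.Barriers.PneNP.Rothvoss2017_tsp`. Combining
`rothvoss2017_tsp_of_weights` (`…RothvossAssembly.lean`: Cor. 2 from any weights `A - B`
supported on `Q_3`/`Q_k` with a rectangle bound) with the laws of Rothvoß's two sampling
procedures (`…RothvossSampling.lean`: `law` = uniform measure on the sample space `Ω_r` of
compatible triples `(T, U, M)`, its support, total mass `1`, and the identity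
`Σ_{X×Y} law = |Ω_r ∩ (X × Y)| / |Ω_r|`), the named fact is reduced to the single inequality
between the two sample spaces that Rothvoß's §§3.3–3.6 prove (Lemma 7, PDF p. 8, in the form
`|Ω_3 ∩ R|/|Ω_3| ≤ (400/k²) |Ω_k ∩ R|/|Ω_k| + 2^{-δm}` for rectangles `R` avoiding `Q_1`; `k` a
large odd constant, `400/k² ≤ 1/(k-1)`):

* `rothvoss2017_tsp_of_sampler_bound` — that inequality, for some odd `k ≥ 401`, `δ > 0` and all
  large odd `m`, implies `Rothvoss2017_tsp`.

Sources: [Rothvoss2017] §2 (PDF pp. 6–7), Lemma 7 and its derivation of Lemma 6 (PDF p. 8),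
§3.2 (PDF p. 9).
-/

noncomputable section

namespace Literature.Barriers.PneNP

open Finset Filter Literature.Combinatorics.SimpleGraph.CycleSpace

/-- Sums over the subtype of odd cuts are sums over the `Finset` of odd cuts. [folklore] -/
theorem sum_oddSet_eq {n : ℕ} (f : Finset (Fin n) → ℝ) :
    ∑ U : OddSet n, f U.1 = ∑ U ∈ (univ.filter fun U : Finset (Fin n) => Odd U.card), f U :=
  (Finset.sum_subtype _ (by simp) f).symm

/-- Sums over the subtype of perfect matchings are sums over `perfectMatchings univ`.
[folklore] -/
theorem sum_pMatch_eq {n : ℕ} (f : Finset (Sym2 (Fin n)) → ℝ) :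
    ∑ M : PMatch n, f M.1 = ∑ M ∈ perfectMatchings (univ : Finset (Fin n)), f M :=
  (Finset.sum_subtype _ (fun _ => mem_perfectMatchings) f).symm

/-- Sums over a `Finset` of a subtype are sums over its image. [folklore] -/
theorem sum_finset_subtype_eq {α : Type*} {p : α → Prop} (X : Finset {a // p a}) (f : α → ℝ) :
    ∑ a ∈ X, f a.1 = ∑ a ∈ X.map (Function.Embedding.subtype p), f a := by
  rw [sum_map]; rfl

/-- **`Ω_3` and `Ω_k` are nonempty at Rothvoß's parameters** (`k ≥ 5` odd, `m ≥ 1` odd,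
`n = 3m(k-3) + 2k`, `t = (m+1)(k-3)/2 + 3`; `r = 3` uses `(m+1)/2` `A`-blocks in the cut,
`r = k` uses `(m-1)/2`). [cite: Rothvoss2017, §3.2 (PDF p. 9)] -/
theorem omega_nonempty_params {k m r : ℕ} (hk : 5 ≤ k) (hko : k % 2 = 1) (hm : 1 ≤ m)
    (hr : r = 3 ∨ r = k) :
    (Omega (3 * m * (k - 3) + 2 * k) m k ((m + 1) / 2 * (k - 3) + 3) r).Nonempty := by
  have hkodd : Odd k := Nat.odd_iff.2 hko
  have hk3 : Even (k - 3) := ⟨(k - 3) / 2, by omega⟩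
  refine omega_nonempty (partitions_nonempty m k)
    (fun lab hlab => cdMatchings_nonempty hlab (by omega)) (fun lab hlab H hH => ?_)
    (fun lab hlab H hH => mext_nonempty hlab hH hkodd (by omega) ?_)
  · rcases hr with rfl | hrk
    · exact uext_nonempty hlab hH (j := (m + 1) / 2) (by omega) (by ring)
    · refine uext_nonempty hlab hH (j := (m - 1) / 2) (by omega) ?_
      have hq : (m + 1) / 2 = (m - 1) / 2 + 1 := by omega
      rw [hrk, hq, add_mul, one_mul, add_assoc, Nat.sub_add_cancel (by omega : 3 ≤ k), add_comm]
  · rcases hr with rfl | hrk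
    · exact hk3
    · rw [hrk]; simp

/-- **Total mass `1` of the two laws at Rothvoß's parameters.** [cite: Rothvoss2017, §3.2 (PDF p. 9)] -/
theorem sum_sum_law_univ_params {k m r : ℕ} (hk : 5 ≤ k) (hko : k % 2 = 1) (hm : 1 ≤ m)
    (hr : r = 3 ∨ r = k) :
    ∑ U ∈ (univ.filter fun U : Finset (Fin (3 * m * (k - 3) + 2 * k)) => Odd U.card),
      ∑ M ∈ perfectMatchings (univ : Finset (Fin (3 * m * (k - 3) + 2 * k))),
        law (3 * m * (k - 3) + 2 * k) m k ((m + 1) / 2 * (k - 3) + 3) r U M = 1 := by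
  obtain ⟨-, ht2, -, -⟩ := rothvoss_params (m := m) hk hko hm
  exact sum_sum_law_univ (Nat.odd_iff.2 ht2) (omega_nonempty_params hk hko hm hr)

/-- `400/k² ≤ 1/(k-1)` for `k ≥ 401`. [cite: Rothvoss2017, §3 (PDF p. 8: "400/k² - 1/(k-1) ≤ 0 … (e.g. k = 501)")] -/
theorem coeff_nonpos {k : ℕ} (hk : 401 ≤ k) : 400 / (k : ℝ) ^ 2 - 1 / ((k : ℝ) - 1) ≤ 0 := by
  have hk' : (401 : ℝ) ≤ k := by exact_mod_cast hk
  have h1 : (0 : ℝ) < (k : ℝ) - 1 := by linarith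
  have h2 : (0 : ℝ) < (k : ℝ) ^ 2 := by positivity
  rw [sub_nonpos, div_le_div_iff₀ h2 h1]
  nlinarith

/-- **Rothvoß 2017, Cor. 2, from the sampler inequality.** Suppose that for some odd
`k ≥ 401`, `δ > 0`, `m₀`, and every odd `m ≥ m₀` (`n = 3m(k-3) + 2k`,
`t = (m+1)(k-3)/2 + 3`), every rectangle `X × Y` of vertex sets and edge sets of `K_n` none of
whose entries has exactly one crossing matching edge (`μ_1 = 0`) satisfies
`|Ω_3 ∩ (X × Y)|/|Ω_3| ≤ (400/k²) · |Ω_k ∩ (X × Y)|/|Ω_k| + 2^{-δm}` — Rothvoß's Lemma 7 for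
the two sample spaces of compatible triples. Then `Rothvoss2017_tsp` holds (through
`rothvoss2017_tsp_of_weights` with `A =` law of the `3`-sampler, `B =` law of the `k`-sampler
`/(k-1)`). [cite: Rothvoss2017, Lemma 7 (PDF p. 8), §3.2 (PDF p. 9), §2 (PDF pp. 6–7)] -/
theorem rothvoss2017_tsp_of_sampler_bound {k : ℕ} (hk : 401 ≤ k) (hko : k % 2 = 1) {δ : ℝ}
    (hδ : 0 < δ) {m₀ : ℕ}
    (hL7 : ∀ m : ℕ, m₀ ≤ m → m % 2 = 1 →
      ∀ (X : Finset (Finset (Fin (3 * m * (k - 3) + 2 * k))))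
        (Y : Finset (Finset (Sym2 (Fin (3 * m * (k - 3) + 2 * k))))),
        (∀ U ∈ X, ∀ M ∈ Y, (M.filter (Crosses U)).card ≠ 1) →
        ((OmegaR (3 * m * (k - 3) + 2 * k) m k ((m + 1) / 2 * (k - 3) + 3) 3 X Y).card : ℝ) /
            (Omega (3 * m * (k - 3) + 2 * k) m k ((m + 1) / 2 * (k - 3) + 3) 3).card ≤
          400 / (k : ℝ) ^ 2 *
            (((OmegaR (3 * m * (k - 3) + 2 * k) m k ((m + 1) / 2 * (k - 3) + 3) k X Y).card : ℝ) /
              (Omega (3 * m * (k - 3) + 2 * k) m k ((m + 1) / 2 * (k - 3) + 3) k).card) +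
            (2 : ℝ) ^ (-(δ * m))) :
    Rothvoss2017_tsp := by
  refine rothvoss2017_tsp_of_weights (k := k) (by omega) hδ (m₀ := max m₀ 1) fun m hm hmo => ?_
  have hm₀ : m₀ ≤ m := le_trans (le_max_left _ _) hm
  have hm1 : 1 ≤ m := le_trans (le_max_right _ _) hm
  have hk5 : 5 ≤ k := by omega
  have hk1 : (0 : ℝ) < (k : ℝ) - 1 := by
    have : (401 : ℝ) ≤ k := by exact_mod_cast hk
    linarith
  -- the two laws
  set n := 3 * m * (k - 3) + 2 * k with hn
  set t := (m + 1) / 2 * (k - 3) + 3 with ht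
  refine ⟨fun U M => law n m k t 3 U.1 M.1, fun U M => law n m k t k U.1 M.1 / ((k : ℝ) - 1),
    fun U M h => card_filter_crosses_of_law_ne_zero (n := n) (m := m) (k := k) (t := t) (r := 3) h,
    fun U M h => card_filter_crosses_of_law_ne_zero (n := n) (m := m) (k := k) (t := t) (r := k)
      (fun h0 => h (by show law n m k t k U.1 M.1 / ((k : ℝ) - 1) = 0; rw [h0, zero_div])),
    ?_, ?_, ?_⟩
  · -- total mass of the `3`-sampler
    calc ∑ U : OddSet n, ∑ M : PMatch n, law n m k t 3 U.1 M.1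
        = ∑ U : OddSet n, ∑ M ∈ perfectMatchings (univ : Finset (Fin n)), law n m k t 3 U.1 M :=
          Fintype.sum_congr _ _ fun U => sum_pMatch_eq (fun M => law n m k t 3 U.1 M)
      _ = ∑ U ∈ (univ.filter fun U : Finset (Fin n) => Odd U.card),
            ∑ M ∈ perfectMatchings (univ : Finset (Fin n)), law n m k t 3 U M :=
          sum_oddSet_eq (fun U => ∑ M ∈ perfectMatchings (univ : Finset (Fin n)), law n m k t 3 U M)
      _ = 1 := sum_sum_law_univ_params (r := 3) hk5 hko hm1 (Or.inl rfl)
  · -- total mass of the `k`-sampler, divided by `k - 1`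
    have hmass : ∑ U : OddSet n, ∑ M : PMatch n, law n m k t k U.1 M.1 = 1 :=
      calc ∑ U : OddSet n, ∑ M : PMatch n, law n m k t k U.1 M.1
          = ∑ U : OddSet n, ∑ M ∈ perfectMatchings (univ : Finset (Fin n)), law n m k t k U.1 M :=
            Fintype.sum_congr _ _ fun U => sum_pMatch_eq (fun M => law n m k t k U.1 M)
        _ = ∑ U ∈ (univ.filter fun U : Finset (Fin n) => Odd U.card),
              ∑ M ∈ perfectMatchings (univ : Finset (Fin n)), law n m k t k U M :=
            sum_oddSet_eq (fun U => ∑ M ∈ perfectMatchings (univ : Finset (Fin n)), law n m k t k U M)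
        _ = 1 := sum_sum_law_univ_params (r := k) hk5 hko hm1 (Or.inr rfl)
    have hpull : ∑ U : OddSet n, ∑ M : PMatch n, law n m k t k U.1 M.1 / ((k : ℝ) - 1) =
        (∑ U : OddSet n, ∑ M : PMatch n, law n m k t k U.1 M.1) / ((k : ℝ) - 1) := by
      simp only [← Finset.sum_div]
    rw [hpull, hmass, div_mul_cancel₀ _ hk1.ne']
  · -- the rectangle bound
    intro X Y hXY
    set X' := X.map (Function.Embedding.subtype _) with hX'
    set Y' := Y.map (Function.Embedding.subtype _) with hY'
    have havoid : ∀ U ∈ X', ∀ M ∈ Y', (M.filter (Crosses U)).card ≠ 1 := by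
      intro U hU M hM
      obtain ⟨U₀, hU₀, rfl⟩ := mem_map.1 hU
      obtain ⟨M₀, hM₀, rfl⟩ := mem_map.1 hM
      exact hXY U₀ hU₀ M₀ hM₀
    -- the proportions of `Ω_r` inside the rectangle
    set E : ℕ → ℝ := fun r => ((OmegaR n m k t r X' Y').card : ℝ) / (Omega n m k t r).card with hE
    have hconv : ∀ r, ∑ U ∈ X, ∑ M ∈ Y, law n m k t r U.1 M.1 = E r := by
      intro r
      calc ∑ U ∈ X, ∑ M ∈ Y, law n m k t r U.1 M.1
          = ∑ U ∈ X, ∑ M ∈ Y', law n m k t r U.1 M :=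
            sum_congr rfl fun U _ => sum_finset_subtype_eq Y (fun M => law n m k t r U.1 M)
        _ = ∑ U ∈ X', ∑ M ∈ Y', law n m k t r U M :=
            sum_finset_subtype_eq X (fun U => ∑ M ∈ Y', law n m k t r U M)
        _ = E r := sum_sum_law_eq t r X' Y'
    have h3 := hconv 3
    have hk' : ∑ U ∈ X, ∑ M ∈ Y, law n m k t k U.1 M.1 / ((k : ℝ) - 1) = E k / ((k : ℝ) - 1) := by
      simp only [← Finset.sum_div]
      rw [hconv k]
    simp only [sum_sub_distrib]
    rw [h3, hk']
    have hbound : E 3 ≤ 400 / (k : ℝ) ^ 2 * E k + (2 : ℝ) ^ (-(δ * m)) := hL7 m hm₀ hmo X' Y' havoid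
    have hEk : 0 ≤ E k := div_nonneg (Nat.cast_nonneg _) (Nat.cast_nonneg _)
    have hc := coeff_nonpos hk
    have : E 3 - E k / ((k : ℝ) - 1) ≤
        (400 / (k : ℝ) ^ 2 - 1 / ((k : ℝ) - 1)) * E k + (2 : ℝ) ^ (-(δ * m)) := by
      rw [sub_mul, div_eq_mul_one_div (E k) ((k : ℝ) - 1), mul_comm (E k)]
      linarith
    nlinarith

end Literature.Barriers.PneNP
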